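import Summits.NavierStokesRegularity.NavierStokesRegularity.Theorems.CoriolisHeadLocalEnergyDensityBootstrap
import Summits.NavierStokesRegularity.NavierStokesRegularity.Theorems.CoriolisHeadNoCoRotatingCoreNormalForm
import HarnessLib

/-!
# CoriolisHeadLocalEnergyDensity — crux `NoCoRotatingCore` (stmt-NavierStokesRegularity-22676), line `local_energy_rescue`
# v2.1 (crux workfile `Cruxes/NoCoRotatingCore/Lines/local_energy_rescue.lean`, ns-idea-10 g3; NOT the registered skeleton):
# **stub S2 `stub_densityBootstrap` proved, statement verbatim** (seat ns-ffc-k1 g2, helper; file 4 of 4)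

S2 (the line's NEW step): a bounded smooth rotated Leray profile (ANY `ν, a > 0`, ANY skew `B`) whose pressure has bounded
mean oscillation `∫_{B(z,ρ)}(P − m)² ≤ Kρ³` has SUB-VOLUME energy density: `∫_{B(z,ρ)}‖U‖² ≤ K₂ ρ^{3−β}` with `β = 3/2 > 1`
for all `ρ ≥ 1`, uniformly in the centre.

PROOF.  Normal form (`rotatedProfileSystem_normalise` + `…_axisNormalForm`, tree): `V(y) = L((c/ν)U(cL⁻¹y))`,
`Q(y) = (c/ν)²P(cL⁻¹y)` is a Pineau–Vicol profile; the `BMO₂` bound and the ball energies transform under the similarity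
`y ↦ cL⁻¹y` (`setIntegral_ball_comp_smul_isometry`); then the physical local energy bootstrap of files 1–3
(`density_three_halves`: the fixed-cut-off local energy identity of the rotated self-similar field `u = pvAnsatz α V`, read in
similarity variables, two rounds `β: 0 → 1 → 3/2`).  Small scales `1 ≤ ρ < c` are covered by the trivial bound.

HONEST FRAMING.  A helper for an UNREGISTERED line (no stub credit claimed).  With S3b (landed,
`CoriolisHeadLocalEnergyDecayOfTopNull`) this leaves S1 (drift normal form ⇒ `BMO₂` pressure, in print) and S3a (CKN class,
Calderón–Zygmund) of that line open; together they would give far-field constancy at the Type-I rate (K1 of line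
`far_field_constancy`) without K1a.  Nothing here proves `NoCoRotatingCore`, Pineau–Vicol's Conjecture 1.1 or NS regularity.

References: D. Chae, J. Wolf, arXiv:1610.09464, §2 Step 2 [ChaeWolf2017RemovingDSS]; B. Pineau, V. Vicol, arXiv:2607.09619,
(1.7)–(1.8) [PineauVicol2026]; line card `Lines/local_energy_rescue.md`.
-/

noncomputable section

open MeasureTheory Set Function Filter Topology Metric InnerProductSpace Real
open scoped RealInnerProductSpace Laplacian ContDiff Topology

-- the summit and its single sub-problem share the name (CONVENTIONS §1), as in every Theorems file
set_option linter.dupNamespace false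

namespace Summit.NavierStokesRegularity.NavierStokesRegularity.Theorems.CoriolisHead

namespace LocalEnergyRescue

open Literature.Analysis.FluidPDE

/-! ## §9 Back to the general frame `(ν, a, B)` -/

/-- `∫ g(c T y) dy = c⁻³ ∫ g` for a linear isometry `T` and `c > 0`. [folklore] -/
theorem integral_comp_smul_isometry (g : EuclideanSpace ℝ (Fin 3) → ℝ) {c : ℝ} (hc : 0 < c)
    (T : EuclideanSpace ℝ (Fin 3) ≃ₗᵢ[ℝ] EuclideanSpace ℝ (Fin 3)) :
    ∫ y, g (c • T y) = (c ^ 3)⁻¹ * ∫ x, g x := by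
  have h1 : ∫ y, g (c • T y) = ∫ x, g (c • x) := by
    have h := T.measurePreserving.integral_comp T.toHomeomorph.measurableEmbedding (fun x => g (c • x))
    simpa using h
  rw [h1, Measure.integral_comp_smul_of_nonneg volume g c (hR := hc.le), finrank_euclideanSpace_fin,
    smul_eq_mul]

/-- **Change of variables on a ball by a similarity**: `∫_{B(x₀,r)} g = c³ ∫_{B(c⁻¹T⁻¹x₀, r/c)} g(cTy) dy`. [folklore] -/
theorem setIntegral_ball_comp_smul_isometry (g : EuclideanSpace ℝ (Fin 3) → ℝ) {c : ℝ} (hc : 0 < c)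
    (T : EuclideanSpace ℝ (Fin 3) ≃ₗᵢ[ℝ] EuclideanSpace ℝ (Fin 3)) (x₀ : EuclideanSpace ℝ (Fin 3)) (r : ℝ) :
    ∫ x in ball x₀ r, g x = c ^ 3 * ∫ y in ball (c⁻¹ • T.symm x₀) (r / c), g (c • T y) := by
  set z := c⁻¹ • T.symm x₀ with hz
  have hx₀ : x₀ = c • T z := by
    rw [hz, LinearIsometryEquiv.map_smul, smul_smul, mul_inv_cancel₀ hc.ne', one_smul,
      LinearIsometryEquiv.apply_symm_apply]
  have hdist : ∀ y, dist (c • T y) x₀ = c * dist y z := fun y => by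
    rw [dist_eq_norm, dist_eq_norm, hx₀, ← smul_sub, ← map_sub, norm_smul, Real.norm_of_nonneg hc.le,
      LinearIsometryEquiv.norm_map]
  rw [← integral_indicator measurableSet_ball, ← integral_indicator measurableSet_ball]
  have key : ∀ y, (ball z (r / c)).indicator (fun y => g (c • T y)) y = (ball x₀ r).indicator g (c • T y) := by
    intro y
    have hmem : y ∈ ball z (r / c) ↔ c • T y ∈ ball x₀ r := by
      rw [mem_ball, mem_ball, hdist y, lt_div_iff₀ hc, mul_comm]
    by_cases hy : y ∈ ball z (r / c)
    · rw [indicator_of_mem hy, indicator_of_mem (hmem.1 hy)]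
    · rw [indicator_of_notMem hy, indicator_of_notMem (fun h => hy (hmem.2 h))]
  simp_rw [key]
  rw [integral_comp_smul_isometry _ hc T]
  have hc3 : c ^ 3 ≠ 0 := by positivity
  field_simp

/-- `ρ^{3/2} = ρ√ρ` as a real power: `ρ ^ (3 − 3/2) = ρ √ρ` for `ρ > 0`. [folklore] -/
theorem rpow_three_sub_three_halves {ρ : ℝ} (hρ : 0 < ρ) : ρ ^ ((3 : ℝ) - 3 / 2) = ρ * Real.sqrt ρ := by
  rw [show (3 : ℝ) - 3 / 2 = 1 + 1 / 2 by norm_num, Real.rpow_add hρ, Real.rpow_one, Real.sqrt_eq_rpow]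

end LocalEnergyRescue

/-! ## §10 Stub S2 by name -/

open LocalEnergyRescue Literature.Analysis.FluidPDE in
/-- **stub S2 — `stub_densityBootstrap`** of the line `local_energy_rescue` v2.1 (crux `CoriolisHead.NoCoRotatingCore`, item
22676; statement verbatim from the crux workfile `Lines/local_energy_rescue.lean`, with the skeleton's local notation `E3`
spelled out as `EuclideanSpace ℝ (Fin 3)`): a bounded smooth rotated profile (ANY `ν, a > 0`, ANY skew `B`) whose pressure has
bounded mean oscillation (`∫_{B(z,ρ)}(P − m)² ≤ Kρ³`) has SUB-VOLUME energy density `∫_{B(z,ρ)}‖U‖² ≤ K₂ρ^{3−β}`, `β = 3/2 > 1`,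
for all `ρ ≥ 1`.  Proof: normal form to a Pineau–Vicol profile (`rotatedProfileSystem_normalise`, `…_axisNormalForm`; the
`BMO₂` bound and the ball energies transform by a similarity), then the two-round physical energy bootstrap
`density_three_halves`.  The line is unregistered: this is a helper, no stub credit is claimed; S1 (drift normal form), S3a
(CKN class), K1a, `NoCoRotatingCore` and NS regularity are NOT proved here. [cite: ChaeWolf2017RemovingDSS, §2 Step 2 (arXiv p. 5)] -/
theorem stub_densityBootstrap :
    ∀ (ν a : ℝ), 0 < ν → 0 < a → ∀ (B : EuclideanSpace ℝ (Fin 3) →L[ℝ] EuclideanSpace ℝ (Fin 3))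
      (U : EuclideanSpace ℝ (Fin 3) → EuclideanSpace ℝ (Fin 3)) (P : EuclideanSpace ℝ (Fin 3) → ℝ),
      ContDiff ℝ (⊤ : ℕ∞) U → ContDiff ℝ 2 P → (∀ x, inner ℝ (B x) x = 0) →
      Literature.Analysis.FluidPDE.VectorCalculus.IsDivFree U →
      (∀ y, -(ν • Laplacian.laplacian U y) + a • U y + a • fderiv ℝ U y y
        + (B (U y) - fderiv ℝ U y (B y)) + Literature.Analysis.FluidPDE.convect U U y
        + gradient P y = 0) →
      (∃ M : ℝ, ∀ y, ‖U y‖ ≤ M) →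
      ∀ K : ℝ,
      (∀ (z : EuclideanSpace ℝ (Fin 3)) (ρ : ℝ), 0 < ρ →
        ∃ m : ℝ, ∫ y in Metric.ball z ρ, (P y - m) ^ 2 ≤ K * ρ ^ 3) →
      ∃ (β K₂ : ℝ), 1 < β ∧
        (∀ (z : EuclideanSpace ℝ (Fin 3)) (ρ : ℝ), 1 ≤ ρ →
          ∫ y in Metric.ball z ρ, ‖U y‖ ^ 2 ≤ K₂ * ρ ^ (3 - β)) := by
  intro ν a hν ha B U P hU hP hB hdiv heq hbdd K hPK
  obtain ⟨M, hM⟩ := hbdd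
  have hM0 : 0 ≤ M := (norm_nonneg _).trans (hM 0)
  have hK0 : 0 ≤ K := by
    obtain ⟨m, hm⟩ := hPK 0 1 one_pos
    have h0 : 0 ≤ ∫ y in ball (0 : EuclideanSpace ℝ (Fin 3)) 1, (P y - m) ^ 2 :=
      setIntegral_nonneg measurableSet_ball fun y _ => sq_nonneg _
    linarith
  -- normal form
  obtain ⟨c, hc0, hk2, hW, hR, hB', hdivW, heqW, -⟩ :=
    rotatedProfileSystem_normalise hν ha hU (hP.of_le (by norm_num)) hB hdiv heq
  obtain ⟨L, α, hV, hQ, hdivV, heqV, hnormV, -⟩ := rotatedProfileSystem_axisNormalForm hW hR hB' hdivW heqW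
  set k : ℝ := c / ν with hk
  have hkpos : 0 < k := div_pos hc0 hν
  set V : EuclideanSpace ℝ (Fin 3) → EuclideanSpace ℝ (Fin 3) := fun y => L (k • U (c • L.symm y)) with hVdef
  set Q : EuclideanSpace ℝ (Fin 3) → ℝ := fun y => k ^ 2 * P (c • L.symm y) with hQdef
  -- amplitude of the Pineau–Vicol profile
  have hMV : ∀ y, ‖V y‖ ≤ k * M := fun y => by
    rw [hnormV y, norm_smul, Real.norm_of_nonneg hkpos.le]
    exact mul_le_mul_of_nonneg_left (hM _) hkpos.le
  -- `BMO₂` of the Pineau–Vicol pressure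
  have hPV : ∀ (z : EuclideanSpace ℝ (Fin 3)) (ρ : ℝ), 0 < ρ →
      ∃ m : ℝ, ∫ y in ball z ρ, (Q y - m) ^ 2 ≤ (k ^ 4 * K) * ρ ^ 3 := by
    intro z ρ hρ
    obtain ⟨m₀, hm₀⟩ := hPK (c • L.symm z) (c * ρ) (by positivity)
    refine ⟨k ^ 2 * m₀, ?_⟩
    have hsub := setIntegral_ball_comp_smul_isometry (fun w => (P w - m₀) ^ 2) hc0 L.symm (c • L.symm z) (c * ρ)
    rw [LinearIsometryEquiv.symm_symm, LinearIsometryEquiv.map_smul, LinearIsometryEquiv.apply_symm_apply, smul_smul,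
      inv_mul_cancel₀ hc0.ne', one_smul, mul_div_cancel_left₀ _ hc0.ne'] at hsub
    have e : ∀ y, (Q y - k ^ 2 * m₀) ^ 2 = k ^ 4 * (P (c • L.symm y) - m₀) ^ 2 := fun y => by
      simp only [hQdef]; ring
    simp_rw [e]
    rw [integral_const_mul]
    have hc3 : 0 < c ^ 3 := by positivity
    have hI : ∫ y in ball z ρ, (P (c • L.symm y) - m₀) ^ 2 ≤ K * ρ ^ 3 := by
      have h2 : c ^ 3 * ∫ y in ball z ρ, (P (c • L.symm y) - m₀) ^ 2 ≤ K * (c * ρ) ^ 3 := by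
        rw [← hsub]; exact hm₀
      have h3 : K * (c * ρ) ^ 3 = c ^ 3 * (K * ρ ^ 3) := by ring
      rw [h3] at h2
      exact le_of_mul_le_mul_left h2 hc3
    calc k ^ 4 * ∫ y in ball z ρ, (P (c • L.symm y) - m₀) ^ 2 ≤ k ^ 4 * (K * ρ ^ 3) :=
          mul_le_mul_of_nonneg_left hI (by positivity)
      _ = k ^ 4 * K * ρ ^ 3 := by ring
  -- the bootstrap for the Pineau–Vicol profile
  obtain ⟨A₂, hA₂, hdens⟩ := density_three_halves (α := α) hV hQ hdivV heqV hMV hPV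
  -- back to `U`: `∫_{B(z,ρ)}‖U‖² = k⁻² c³ ∫_{B(z', ρ/c)} ‖V‖²`, `z' = c⁻¹ L z`
  set W : ℝ := (volume (ball (0 : EuclideanSpace ℝ (Fin 3)) 1)).toReal with hWdef
  set K₂ : ℝ := (k ^ 2)⁻¹ * c ^ 3 * A₂ * (c * Real.sqrt c)⁻¹ + M ^ 2 * W * (c * Real.sqrt c) with hK₂
  refine ⟨3 / 2, K₂, by norm_num, fun z ρ hρ => ?_⟩
  have hρ0 : 0 < ρ := by linarith
  rw [rpow_three_sub_three_halves hρ0]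
  have hcs : 0 < c * Real.sqrt c := mul_pos hc0 (Real.sqrt_pos.2 hc0)
  -- the energy in terms of `V`
  have hUV : ∀ x, ‖U x‖ ^ 2 = (k ^ 2)⁻¹ * ‖V (L (c⁻¹ • x))‖ ^ 2 := fun x => by
    have e : V (L (c⁻¹ • x)) = L (k • U x) := by
      simp only [hVdef]
      rw [LinearIsometryEquiv.symm_apply_apply, smul_smul, mul_inv_cancel₀ hc0.ne', one_smul]
    rw [e, LinearIsometryEquiv.norm_map, norm_smul, Real.norm_of_nonneg hkpos.le, mul_pow]
    field_simp
  have hsub := setIntegral_ball_comp_smul_isometry (fun x => ‖V (L (c⁻¹ • x))‖ ^ 2) hc0 L.symm z ρ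
  have e2 : ∀ y, ‖V (L (c⁻¹ • (c • L.symm y)))‖ ^ 2 = ‖V y‖ ^ 2 := fun y => by
    rw [smul_smul, inv_mul_cancel₀ hc0.ne', one_smul, LinearIsometryEquiv.apply_symm_apply]
  simp_rw [e2, LinearIsometryEquiv.symm_symm] at hsub
  have hE : ∫ x in ball z ρ, ‖U x‖ ^ 2 = (k ^ 2)⁻¹ * (c ^ 3 * ∫ y in ball (c⁻¹ • L z) (ρ / c), ‖V y‖ ^ 2) := by
    simp_rw [hUV]
    rw [integral_const_mul, hsub]
  -- two cases according to `ρ/c ≥ 1`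
  have hK₂a : 0 ≤ (k ^ 2)⁻¹ * c ^ 3 * A₂ * (c * Real.sqrt c)⁻¹ := by positivity
  have hK₂b : 0 ≤ M ^ 2 * W * (c * Real.sqrt c) := by positivity
  rcases le_or_gt 1 (ρ / c) with hρc | hρc
  · have h1 := hdens (c⁻¹ • L z) (ρ / c) hρc
    have hsqrt : Real.sqrt (ρ / c) = Real.sqrt ρ / Real.sqrt c := Real.sqrt_div' ρ hc0.le
    have e3 : ρ / c * Real.sqrt (ρ / c) = ρ * Real.sqrt ρ * (c * Real.sqrt c)⁻¹ := by
      rw [hsqrt]; field_simp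
    rw [e3] at h1
    rw [hE]
    have h2 : (k ^ 2)⁻¹ * (c ^ 3 * ∫ y in ball (c⁻¹ • L z) (ρ / c), ‖V y‖ ^ 2) ≤
        (k ^ 2)⁻¹ * c ^ 3 * A₂ * (c * Real.sqrt c)⁻¹ * (ρ * Real.sqrt ρ) := by
      have := mul_le_mul_of_nonneg_left (mul_le_mul_of_nonneg_left h1 (by positivity : (0 : ℝ) ≤ c ^ 3))
        (by positivity : (0 : ℝ) ≤ (k ^ 2)⁻¹)
      refine this.trans (le_of_eq ?_)
      ring
    have h3 : 0 ≤ M ^ 2 * W * (c * Real.sqrt c) * (ρ * Real.sqrt ρ) := by positivity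
    rw [hK₂]
    nlinarith [h2, h3]
  · -- `ρ < c`: the trivial bound `M²Wρ³ ≤ M²W c√c ρ√ρ`
    have hρc' : ρ < c := by rwa [div_lt_one hc0] at hρc
    have htriv : ∫ x in ball z ρ, ‖U x‖ ^ 2 ≤ M ^ 2 * W * ρ ^ 3 := by
      have h := setIntegral_ball_norm_sq_le_cube (V := U) hM z hρ0
      rwa [← hWdef] at h
    have hρ3 : ρ ^ 3 ≤ c * Real.sqrt c * (ρ * Real.sqrt ρ) := by
      have hsρ : Real.sqrt ρ ≤ Real.sqrt c := Real.sqrt_le_sqrt hρc'.le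
      have hsρ0 : 0 ≤ Real.sqrt ρ := Real.sqrt_nonneg _
      have hρρ : ρ * Real.sqrt ρ ≤ c * Real.sqrt c := mul_le_mul hρc'.le hsρ hsρ0 hc0.le
      have e4 : ρ ^ 3 = ρ * Real.sqrt ρ * (ρ * Real.sqrt ρ) := by
        have := Real.mul_self_sqrt hρ0.le
        nlinarith [this]
      rw [e4]
      exact mul_le_mul_of_nonneg_right hρρ (by positivity)
    have h3 : 0 ≤ (k ^ 2)⁻¹ * c ^ 3 * A₂ * (c * Real.sqrt c)⁻¹ * (ρ * Real.sqrt ρ) := by positivity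
    rw [hK₂]
    nlinarith [htriv, hρ3, h3, mul_le_mul_of_nonneg_left hρ3 (by positivity : (0 : ℝ) ≤ M ^ 2 * W)]


end Summit.NavierStokesRegularity.NavierStokesRegularity.Theorems.CoriolisHead

end
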